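import Summits.AnomalousDissipation.AnomalousDissipation.Theorems.SolenoidalFractalHomogenisationRealisedQuasiStaticCellLawCellUnique
import Summits.AnomalousDissipation.AnomalousDissipation.Theorems.SolenoidalFractalHomogenisationRealisedQuasiStaticCellLawSectorPieces
import Summits.AnomalousDissipation.AnomalousDissipation.Theorems.SolenoidalFractalHomogenisationRealisedQuasiStaticCellLawSectorReduction
import Summits.AnomalousDissipation.AnomalousDissipation.Theorems.SolenoidalFractalHomogenisationRealisedQuasiStaticCellLawSectorExists
import Summits.AnomalousDissipation.AnomalousDissipation.Theorems.SolenoidalFractalHomogenisationRealisedQuasiStaticCellLawStubLowSectorWeakFar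
import Summits.AnomalousDissipation.AnomalousDissipation.Theorems.SolenoidalFractalHomogenisationRealisedQuasiStaticCellLawStubLowSectorStrong
import Summits.AnomalousDissipation.AnomalousDissipation.Theorems.SolenoidalFractalHomogenisationRealisedQuasiStaticCellLawStubLowSectorWeakNear
import HarnessLib

/-!
# K2R `RealisedQuasiStaticCellLaw`, line `floquet-bloch`: the LOWER half of the bracket, composed
# (`--supports stmt-AnomalousDissipation-20446`, helper)

Summits-side file (everything proved; no definitions, no named facts). This is the kernel-checked LOWER half of the
registered skeleton r20 of line `floquet-bloch` (sha16 5d75d3efc45ae287), taken out of the 637-line skeleton so that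
the by-name closer of the crux stays short:

* `lowSectorDecay` (= the archived stub `stub_lowSectorDecay`, S1D): every weak `A = 0` solution from an `H¹`
  divergence-free mean-zero datum supported in a LOW Bloch sector `±ℓ + nℤ³` (one with a non-zero frequency `k`,
  `|k|² < Q_δ = 1 + (1−δ)c_W/ν²`) decays like `(K/ν)·exp(−8π²Q_δ(ν/n²)t)` — case split on `‖k‖ ≷ (δ/10⁴)nν` and
  `|k|² ≷ 4` into the three LANDED road stubs `stub_lowSectorStrong` (p591984) / `stub_lowSectorWeakFar` (p591079) /
  `stub_lowSectorWeakNear` (p598121), regimes merged by `M₀ = max`, `ν₀ = min`, `K = max`;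
* `lowerSomeSector` (= archived `stub_lowerSomeSector`, S1): one sector-preserving solution with the bound, for data in
  ONE sector, constants uniform in the sector — LOW sectors by `stub_sectorExists` (p543454, `R = 0`) + `lowSectorDecay`,
  HIGH sectors by `stub_sectorExists` with `R² = max(Q_δ,0)` (plain sector-Poincaré diffusion), prefactor `1 ≤ K'/ν`;
* `lowerSome` (= archived `stub_lowerSome`): all `H¹` data, by the landed sector glue `lowerSome_of_sectorStubs`
  (p530163) fed with `stub_sectorPieces` (p531742) and `lowerSomeSector`;
* `lowerLaw`: the LOWER side `WordGainAtRate (cubatureWord.stretch M hM) ((1−δ)c_W) ν₀ K 1` for EVERY weak solution,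
  from `lowerSome` and the landed weak uniqueness `stub_cellUnique` (p526330);
* monotonicity of `SolenoidalWordDecay` / `WordGainAtRate … 1` in the regime (used by the closer to merge regimes).
-/

set_option linter.dupNamespace false

noncomputable section

namespace Summit.AnomalousDissipation.AnomalousDissipation.Theorems.SolenoidalFractalHomogenisation.RealisedQuasiStaticCellLaw

open Set MeasureTheory
open scoped InnerProductSpace
open Literature.Analysis Literature.Analysis.FunctionSpaces Literature.Analysis.FunctionSpaces.Torus
open Literature.Analysis.FluidPDE Literature.Analysis.FluidPDE.LatticeShear

/-- **S1D (`stub_lowSectorDecay` of skeletons r15–r16), proved from the three landed road stubs.** For every `δ > 0`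
there is `M₀ > 0` such that for every pre-stretch `M ≥ M₀` there is a regime `(ν₀, K)` in which, for every cell number
`n ≥ ⌈K/ν⌉` and every LOW sector (one containing a non-zero frequency `k` with `|k|² < 1 + (1−δ)c_W/ν²`), EVERY weak
`A = 0` solution around the `1/n`-cells of the quasi-statically replayed stretched cubature word (viscosity `ν/n²`) from an
`H¹` divergence-free mean-zero datum supported in that sector has energy at most
`(K/ν)·exp(−8π²(1 + (1−δ)c_W/ν²)(ν/n²)t)` times the initial energy. Case split on `‖k‖ ≷ (δ/10⁴)nν` and `|k|² ≷ 4`. -/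
theorem lowSectorDecay : ∀ δ > (0:ℝ), ∃ M₀ > (0:ℝ), ∀ M : ℝ, ∀ hM : 0 < M, M₀ ≤ M → ∃ ν₀ > (0:ℝ), ∃ K > (0:ℝ),
    ∀ ν, ∀ hν : ν ∈ Ioo 0 ν₀, ∀ n : ℕ, ⌈K / ν⌉₊ ≤ n → ∀ ℓ : Fin 3 → ℤ,
    (∃ k : Fin 3 → ℤ, ((∃ z : Fin 3 → ℤ, k = ℓ + (n:ℤ) • z) ∨ (∃ z : Fin 3 → ℤ, k = -ℓ + (n:ℤ) • z)) ∧ k ≠ 0 ∧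
      FunctionSpaces.Torus.freqNormSq k < 1 + (1 - δ) * ((1 - 4 * cubatureWord.ramp / 3) * c0) / ν ^ 2) →
    ∀ w₀ : UnitAddTorus (Fin 3) → EuclideanSpace ℝ (Fin 3),
      FunctionSpaces.Torus.MemSobolev 1 (FunctionSpaces.EuclideanSpace.complexify ∘ w₀) →
      FunctionSpaces.Torus.IsWeaklyDivFree w₀ → FunctionSpaces.Torus.HasZeroMean w₀ →
      (∀ k : Fin 3 → ℤ, ¬ ((∃ z : Fin 3 → ℤ, k = ℓ + (n:ℤ) • z) ∨ (∃ z : Fin 3 → ℤ, k = -ℓ + (n:ℤ) • z)) →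
        UnitAddTorus.mFourierCoeff (FunctionSpaces.EuclideanSpace.complexify ∘ w₀) k = 0) → ∀ T > (0:ℝ), ∀ w,
      Torus.IsWeakPassiveVectorOn 0 T (ν / (n:ℝ) ^ 2)
          (((cubatureWord.stretch M hM).stretch (1 / ν) (one_div_pos.mpr hν.1)).cell n) w₀ w →
      ∀ᵐ t ∂(volume.restrict (Ioo 0 T)),
        ∫ x, ‖w t x‖ ^ 2 ≤ (K / ν) *
          Real.exp (-(8 * Real.pi ^ 2 * (1 + (1 - δ) * ((1 - 4 * cubatureWord.ramp / 3) * c0) / ν ^ 2) * ν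
            / (n:ℝ) ^ 2) * t) * ∫ x, ‖w₀ x‖ ^ 2 := by
  intro δ hδ
  obtain ⟨M₁, hM₁, H₁⟩ := stub_lowSectorStrong δ hδ
  obtain ⟨M₂, hM₂, H₂⟩ := stub_lowSectorWeakFar δ hδ
  obtain ⟨M₃, hM₃, H₃⟩ := stub_lowSectorWeakNear δ hδ
  refine ⟨max M₁ (max M₂ M₃), lt_max_of_lt_left hM₁, fun M hM hle => ?_⟩
  obtain ⟨ν₁, hν₁, K₁, hK₁, G₁⟩ := H₁ M hM ((le_max_left _ _).trans hle)
  obtain ⟨ν₂, hν₂, K₂, hK₂, G₂⟩ := H₂ M hM ((le_max_left _ _).trans ((le_max_right _ _).trans hle))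
  obtain ⟨ν₃, hν₃, K₃, hK₃, G₃⟩ := H₃ M hM ((le_max_right _ _).trans ((le_max_right _ _).trans hle))
  refine ⟨min ν₁ (min ν₂ ν₃), lt_min hν₁ (lt_min hν₂ hν₃), max K₁ (max K₂ K₃), lt_max_of_lt_left hK₁, ?_⟩
  intro ν hν n hn ℓ hsec w₀ hw₀ hdiv hmean hsupp T hT w hw
  have hν1 : ν ∈ Ioo 0 ν₁ := ⟨hν.1, lt_of_lt_of_le hν.2 (min_le_left _ _)⟩
  have hν2 : ν ∈ Ioo 0 ν₂ := ⟨hν.1, lt_of_lt_of_le hν.2 ((min_le_right _ _).trans (min_le_left _ _))⟩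
  have hν3 : ν ∈ Ioo 0 ν₃ := ⟨hν.1, lt_of_lt_of_le hν.2 ((min_le_right _ _).trans (min_le_right _ _))⟩
  have hceil : ∀ K', K' ≤ max K₁ (max K₂ K₃) → ⌈K' / ν⌉₊ ≤ n := fun K' hK' =>
    (Nat.ceil_mono (div_le_div_of_nonneg_right hK' hν.1.le)).trans hn
  have hn1 := hceil K₁ (le_max_left _ _)
  have hn2 := hceil K₂ ((le_max_left _ _).trans (le_max_right _ _))
  have hn3 := hceil K₃ ((le_max_right _ _).trans (le_max_right _ _))
  -- the bound with a smaller constant implies the bound with `K = max`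
  have hE0 : 0 ≤ ∫ x, ‖w₀ x‖ ^ 2 := integral_nonneg fun x => by positivity
  have hmono : ∀ K', K' ≤ max K₁ (max K₂ K₃) → ∀ t : ℝ, (K' / ν) *
      Real.exp (-(8 * Real.pi ^ 2 * (1 + (1 - δ) * ((1 - 4 * cubatureWord.ramp / 3) * c0) / ν ^ 2) * ν
        / (n:ℝ) ^ 2) * t) * ∫ x, ‖w₀ x‖ ^ 2 ≤ (max K₁ (max K₂ K₃) / ν) *
      Real.exp (-(8 * Real.pi ^ 2 * (1 + (1 - δ) * ((1 - 4 * cubatureWord.ramp / 3) * c0) / ν ^ 2) * ν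
        / (n:ℝ) ^ 2) * t) * ∫ x, ‖w₀ x‖ ^ 2 := fun K' hK' t =>
    mul_le_mul_of_nonneg_right (mul_le_mul_of_nonneg_right (div_le_div_of_nonneg_right hK' hν.1.le)
      (Real.exp_pos _).le) hE0
  obtain ⟨k, hkcos, hk0, hkQ⟩ := hsec
  by_cases hS : δ / 10000 * ((n:ℝ) * ν) ≤ ‖FunctionSpaces.Torus.latticeVec k‖
  · have h := G₁ ν hν1 n hn1 ℓ ⟨k, hkcos, hk0, hkQ, hS⟩ w₀ hw₀ hdiv hmean hsupp T hT w hw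
    filter_upwards [h] with t ht
    exact ht.trans (hmono K₁ (le_max_left _ _) t)
  · have hW : ‖FunctionSpaces.Torus.latticeVec k‖ ≤ δ / 10000 * ((n:ℝ) * ν) := (not_le.1 hS).le
    by_cases h4 : 4 ≤ FunctionSpaces.Torus.freqNormSq k
    · have h := G₂ ν hν2 n hn2 ℓ ⟨k, hkcos, hk0, hkQ, hW, h4⟩ w₀ hw₀ hdiv hmean hsupp T hT w hw
      filter_upwards [h] with t ht
      exact ht.trans (hmono K₂ ((le_max_left _ _).trans (le_max_right _ _)) t)
    · -- `|k|²` is an integer `< 4`, hence `≤ 3`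
      have h3 : FunctionSpaces.Torus.freqNormSq k ≤ 3 := by
        have e : FunctionSpaces.Torus.freqNormSq k = ((∑ i, k i ^ 2 : ℤ) : ℝ) := by
          unfold FunctionSpaces.Torus.freqNormSq; push_cast; rfl
        rw [e] at h4 ⊢
        have : (∑ i, k i ^ 2 : ℤ) ≤ 3 := by
          by_contra hc
          push Not at hc
          exact h4 (by exact_mod_cast hc)
        exact_mod_cast this
      have h := G₃ ν hν3 n hn3 ℓ ⟨k, hkcos, hk0, hkQ, hW, h3⟩ w₀ hw₀ hdiv hmean hsupp T hT w hw
      filter_upwards [h] with t ht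
      exact ht.trans (hmono K₃ ((le_max_right _ _).trans (le_max_right _ _)) t)

/-- **S1 (`stub_lowerSomeSector` of skeleton r14), proved from `stub_sectorExists` (S1E) + `lowSectorDecay` (S1D).**
In a LOW sector take the Galerkin solution of S1E (with `R = 0`) and bound it by S1D; in a HIGH sector (`|k|² ≥ Q_δ` on its
non-zero frequencies) S1E with `R² = max(Q_δ,0)` gives the required rate outright, the prefactor being `1 ≤ K'/ν` for
`K' = max K ν₀`. The solution stays in its sector for a.e. `t`. -/
theorem lowerSomeSector : ∀ δ > (0:ℝ), ∃ M₀ > (0:ℝ), ∀ M : ℝ, ∀ hM : 0 < M, M₀ ≤ M → ∃ ν₀ > (0:ℝ), ∃ K > (0:ℝ),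
    ∀ ν, ∀ hν : ν ∈ Ioo 0 ν₀, ∀ n : ℕ, ⌈K / ν⌉₊ ≤ n → ∀ ℓ : Fin 3 → ℤ,
    ∀ w₀ : UnitAddTorus (Fin 3) → EuclideanSpace ℝ (Fin 3),
      FunctionSpaces.Torus.MemSobolev 1 (FunctionSpaces.EuclideanSpace.complexify ∘ w₀) →
      FunctionSpaces.Torus.IsWeaklyDivFree w₀ → FunctionSpaces.Torus.HasZeroMean w₀ →
      (∀ k : Fin 3 → ℤ, ¬ ((∃ z : Fin 3 → ℤ, k = ℓ + (n:ℤ) • z) ∨ (∃ z : Fin 3 → ℤ, k = -ℓ + (n:ℤ) • z)) →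
        UnitAddTorus.mFourierCoeff (FunctionSpaces.EuclideanSpace.complexify ∘ w₀) k = 0) → ∀ T > (0:ℝ),
      ∃ w, Torus.IsWeakPassiveVectorOn 0 T (ν / (n:ℝ) ^ 2)
          (((cubatureWord.stretch M hM).stretch (1 / ν) (one_div_pos.mpr hν.1)).cell n) w₀ w ∧
        (∀ᵐ t ∂(volume.restrict (Ioo 0 T)), ∀ k : Fin 3 → ℤ,
          ¬ ((∃ z : Fin 3 → ℤ, k = ℓ + (n:ℤ) • z) ∨ (∃ z : Fin 3 → ℤ, k = -ℓ + (n:ℤ) • z)) →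
          UnitAddTorus.mFourierCoeff (FunctionSpaces.EuclideanSpace.complexify ∘ w t) k = 0) ∧
        ∀ᵐ t ∂(volume.restrict (Ioo 0 T)),
          ∫ x, ‖w t x‖ ^ 2 ≤ (K / ν) *
            Real.exp (-(8 * Real.pi ^ 2 * (1 + (1 - δ) * ((1 - 4 * cubatureWord.ramp / 3) * c0) / ν ^ 2) * ν
              / (n:ℝ) ^ 2) * t) * ∫ x, ‖w₀ x‖ ^ 2 := by
  intro δ hδ
  obtain ⟨M₀, hM₀, H⟩ := lowSectorDecay δ hδ
  refine ⟨M₀, hM₀, fun M hM hle => ?_⟩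
  obtain ⟨ν₀, hν₀, K, hK, H1⟩ := H M hM hle
  -- enlarge the threshold constant so that the prefactor `K'/ν` is at least `1`
  refine ⟨ν₀, hν₀, max K ν₀, lt_max_of_lt_left hK, ?_⟩
  intro ν hν n hn ℓ w₀ hw₀ hdiv hmean hsupp T hT
  set Q : ℝ := 1 + (1 - δ) * ((1 - 4 * cubatureWord.ramp / 3) * c0) / ν ^ 2 with hQ
  set W' := (cubatureWord.stretch M hM).stretch (1 / ν) (one_div_pos.mpr hν.1) with hW'
  have hKν : K / ν ≤ max K ν₀ / ν := div_le_div_of_nonneg_right (le_max_left _ _) hν.1.le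
  have hn' : ⌈K / ν⌉₊ ≤ n := le_trans (Nat.ceil_mono hKν) hn
  have hn0 : 0 < n := lt_of_lt_of_le (Nat.ceil_pos.mpr (div_pos hK hν.1)) hn'
  have hnpos : (0:ℝ) < n := by exact_mod_cast hn0
  have hκ : 0 < ν / (n:ℝ) ^ 2 := div_pos hν.1 (by positivity)
  have hpref : 1 ≤ max K ν₀ / ν := by
    rw [le_div_iff₀ hν.1, one_mul]
    exact le_trans hν.2.le (le_max_right _ _)
  have hI : 0 ≤ ∫ x, ‖w₀ x‖ ^ 2 := integral_nonneg fun x => by positivity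
  by_cases hlow : ∃ k : Fin 3 → ℤ, ((∃ z : Fin 3 → ℤ, k = ℓ + (n:ℤ) • z) ∨ (∃ z : Fin 3 → ℤ, k = -ℓ + (n:ℤ) • z)) ∧ k ≠ 0 ∧
      FunctionSpaces.Torus.freqNormSq k < Q
  · -- LOW sector: Galerkin solution (S1E, `R = 0`) bounded by S1D
    obtain ⟨w, hw, hinv, -⟩ := stub_sectorExists 26 W' n hn0 _ hκ ℓ 0
      (fun k _ _ => by rw [sq, zero_mul]; exact FunctionSpaces.Torus.freqNormSq_nonneg k) w₀ hw₀ hdiv hmean hsupp T hT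
    refine ⟨w, hw, hinv, ?_⟩
    have hb := H1 ν hν n hn' ℓ hlow w₀ hw₀ hdiv hmean hsupp T hT w hw
    filter_upwards [hb] with t ht
    refine ht.trans ?_
    have hE : 0 ≤ Real.exp (-(8 * Real.pi ^ 2 * (1 + (1 - δ) * ((1 - 4 * cubatureWord.ramp / 3) * c0) / ν ^ 2) * ν
        / (n:ℝ) ^ 2) * t) := (Real.exp_pos _).le
    exact mul_le_mul_of_nonneg_right (mul_le_mul_of_nonneg_right hKν hE) hI
  · -- HIGH sector: plain diffusion at the sector-Poincaré rate `8π²κ·max(Q,0) ≥ 8π²κQ`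
    push Not at hlow
    obtain ⟨w, hw, hinv, hbd⟩ := stub_sectorExists 26 W' n hn0 _ hκ ℓ (Real.sqrt (max Q 0))
      (fun k hk hk0 => by
        rw [Real.sq_sqrt (le_max_right _ _)]
        exact max_le (hlow k hk hk0) (FunctionSpaces.Torus.freqNormSq_nonneg k)) w₀ hw₀ hdiv hmean hsupp T hT
    refine ⟨w, hw, hinv, ?_⟩
    filter_upwards [hbd, ae_restrict_mem measurableSet_Ioo] with t ht htT
    refine ht.trans ?_
    have hexp : Real.exp (-(8 * Real.pi ^ 2 * (ν / (n:ℝ) ^ 2) * Real.sqrt (max Q 0) ^ 2) * t) ≤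
        Real.exp (-(8 * Real.pi ^ 2 * (1 + (1 - δ) * ((1 - 4 * cubatureWord.ramp / 3) * c0) / ν ^ 2) * ν
          / (n:ℝ) ^ 2) * t) := by
      rw [Real.sq_sqrt (le_max_right _ _), Real.exp_le_exp]
      have e1 : 8 * Real.pi ^ 2 * (1 + (1 - δ) * ((1 - 4 * cubatureWord.ramp / 3) * c0) / ν ^ 2) * ν / (n:ℝ) ^ 2 =
          8 * Real.pi ^ 2 * (ν / (n:ℝ) ^ 2) * Q := by rw [hQ]; ring
      rw [e1]
      have hκt : 0 ≤ 8 * Real.pi ^ 2 * (ν / (n:ℝ) ^ 2) * t := by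
        have := htT.1.le
        positivity
      nlinarith [le_max_left Q 0, hκt]
    have hE : 0 ≤ Real.exp (-(8 * Real.pi ^ 2 * (1 + (1 - δ) * ((1 - 4 * cubatureWord.ramp / 3) * c0) / ν ^ 2) * ν
        / (n:ℝ) ^ 2) * t) * ∫ x, ‖w₀ x‖ ^ 2 := mul_nonneg (Real.exp_pos _).le hI
    calc Real.exp (-(8 * Real.pi ^ 2 * (ν / (n:ℝ) ^ 2) * Real.sqrt (max Q 0) ^ 2) * t) * ∫ x, ‖w₀ x‖ ^ 2
        ≤ Real.exp (-(8 * Real.pi ^ 2 * (1 + (1 - δ) * ((1 - 4 * cubatureWord.ramp / 3) * c0) / ν ^ 2) * ν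
            / (n:ℝ) ^ 2) * t) * ∫ x, ‖w₀ x‖ ^ 2 := mul_le_mul_of_nonneg_right hexp hI
      _ = 1 * (Real.exp (-(8 * Real.pi ^ 2 * (1 + (1 - δ) * ((1 - 4 * cubatureWord.ramp / 3) * c0) / ν ^ 2) * ν
            / (n:ℝ) ^ 2) * t) * ∫ x, ‖w₀ x‖ ^ 2) := (one_mul _).symm
      _ ≤ (max K ν₀ / ν) * (Real.exp (-(8 * Real.pi ^ 2 * (1 + (1 - δ) * ((1 - 4 * cubatureWord.ramp / 3) * c0) / ν ^ 2)
            * ν / (n:ℝ) ^ 2) * t) * ∫ x, ‖w₀ x‖ ^ 2) := mul_le_mul_of_nonneg_right hpref hE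
      _ = (max K ν₀ / ν) * Real.exp (-(8 * Real.pi ^ 2 * (1 + (1 - δ) * ((1 - 4 * cubatureWord.ramp / 3) * c0) / ν ^ 2)
            * ν / (n:ℝ) ^ 2) * t) * ∫ x, ‖w₀ x‖ ^ 2 := (mul_assoc _ _ _).symm

/-- **`stub_lowerSome` of skeleton r13 (Floquet–Bloch construction with the UPPER energy bound), proved.** For every
`δ > 0` there is `M₀ > 0` such that for every pre-stretch `M ≥ M₀` there is a regime `(ν₀, K)` in which every `H¹`
divergence-free mean-zero datum around the `1/n`-cells, `n ≥ ⌈K/ν⌉`, of the stretched cubature word replayed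
quasi-statically (slots `× 1/ν`) at cell viscosity `ν/n²` admits a weak `A = 0` solution on `(0,T)` whose energy is at
most `(K/ν)·exp(−8π²(1 + (1−δ)c_W/ν²)(ν/n²)t)` times the initial energy — the landed sector glue
`lowerSome_of_sectorStubs` fed with `stub_sectorPieces` and `lowerSomeSector`. -/
theorem lowerSome : ∀ δ > (0:ℝ), ∃ M₀ > (0:ℝ), ∀ M : ℝ, ∀ hM : 0 < M, M₀ ≤ M → ∃ ν₀ > (0:ℝ), ∃ K > (0:ℝ),
    ∀ ν, ∀ hν : ν ∈ Ioo 0 ν₀, ∀ n : ℕ, ⌈K / ν⌉₊ ≤ n →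
    ∀ w₀ : UnitAddTorus (Fin 3) → EuclideanSpace ℝ (Fin 3),
      FunctionSpaces.Torus.MemSobolev 1 (FunctionSpaces.EuclideanSpace.complexify ∘ w₀) →
      FunctionSpaces.Torus.IsWeaklyDivFree w₀ → FunctionSpaces.Torus.HasZeroMean w₀ → ∀ T > (0:ℝ),
      ∃ w, Torus.IsWeakPassiveVectorOn 0 T (ν / (n:ℝ) ^ 2)
          (((cubatureWord.stretch M hM).stretch (1 / ν) (one_div_pos.mpr hν.1)).cell n) w₀ w ∧
        ∀ᵐ t ∂(volume.restrict (Ioo 0 T)),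
          ∫ x, ‖w t x‖ ^ 2 ≤ (K / ν) *
            Real.exp (-(8 * Real.pi ^ 2 * (1 + (1 - δ) * ((1 - 4 * cubatureWord.ramp / 3) * c0) / ν ^ 2) * ν
              / (n:ℝ) ^ 2) * t) * ∫ x, ‖w₀ x‖ ^ 2 :=
  lowerSome_of_sectorStubs stub_sectorPieces lowerSomeSector

/-- In the regime `n ≥ ⌈K/ν⌉` with `K, ν > 0` the cell number is positive, so the cell viscosity `ν/n²` is positive. -/
theorem cellKappa_pos_of_ceil_le {K ν : ℝ} (hK : 0 < K) (hν : 0 < ν) {n : ℕ} (hn : (⌈K / ν⌉₊ : ℝ) ≤ n) :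
    0 < ν / (n:ℝ) ^ 2 := by
  have h1 : (1:ℝ) ≤ ⌈K / ν⌉₊ := by exact_mod_cast Nat.one_le_iff_ne_zero.mpr (Nat.ceil_pos.mpr (div_pos hK hν)).ne'
  have hn' : (0:ℝ) < n := lt_of_lt_of_le (lt_of_lt_of_le one_pos h1) hn
  positivity

/-- Energies of a.e.-equal fields agree. -/
theorem energy_congr_ae {w₁ w₂ : UnitAddTorus (Fin 3) → EuclideanSpace ℝ (Fin 3)} (h : w₁ =ᵐ[volume] w₂) :
    ∫ x, ‖w₁ x‖ ^ 2 = ∫ x, ‖w₂ x‖ ^ 2 :=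
  integral_congr_ae (h.mono fun x hx => by simp [hx])

/-- **The LOWER side of the realised cell law for EVERY weak solution** (first inner conjunct of the crux at a fixed
pre-stretch): for every `δ > 0` there is `M₀ > 0` such that every pre-stretch `M ≥ M₀` of the cubature word has a regime
`(ν₀, K)` with `WordGainAtRate (cubatureWord.stretch M hM) ((1−δ)·c_W) ν₀ K 1`, `c_W = (1 − 4·ramp/3)·c0` — from
`lowerSome` (one solution with the bound) and the landed weak uniqueness `stub_cellUnique` (any two weak solutions agree
for a.e. `t`). -/
theorem lowerLaw : ∀ δ > (0:ℝ), ∃ M₀ > (0:ℝ), ∀ M : ℝ, ∀ hM : 0 < M, M₀ ≤ M → ∃ ν₀ > (0:ℝ), ∃ K > (0:ℝ),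
    WordGainAtRate (cubatureWord.stretch M hM) ((1 - δ) * ((1 - 4 * cubatureWord.ramp / 3) * c0)) ν₀ K 1 := by
  intro δ hδ
  obtain ⟨M₀, hM₀, H⟩ := lowerSome δ hδ
  refine ⟨M₀, hM₀, fun M hM hle => ?_⟩
  obtain ⟨ν₀, hν₀, K, hK, H1⟩ := H M hM hle
  refine ⟨ν₀, hν₀, K, hK, ?_⟩
  intro ν hν n hn w₀ hw₀ hdiv hmean T hT w hw
  have hn' : ⌈K / ν⌉₊ ≤ n := by simpa [Real.rpow_one] using hn
  obtain ⟨w', hw', hb⟩ := H1 ν hν n hn' w₀ hw₀ hdiv hmean T hT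
  have hκ : 0 < ν / (n:ℝ) ^ 2 := cellKappa_pos_of_ceil_le hK hν.1 (by exact_mod_cast hn')
  have hu := stub_cellUnique _ _ n _ T hκ w₀ w w' hw hw'
  filter_upwards [hb, hu] with t ht htu
  rw [energy_congr_ae htu]
  simpa [Real.rpow_one] using ht

/-- `SolenoidalWordDecay` is monotone in the prefactor and the threshold. -/
theorem solenoidalWordDecay_mono {k : ℕ} (W : LatticeWord k) (ν Q C C' : ℝ) (n₀ n₀' : ℕ) (hC : C ≤ C')
    (hn : n₀ ≤ n₀') (h : SolenoidalWordDecay W ν Q C n₀) : SolenoidalWordDecay W ν Q C' n₀' := by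
  intro n hn' w₀ hw₀ hdiv hmean T hT w hw
  have h1 := h n (le_trans hn hn') w₀ hw₀ hdiv hmean T hT w hw
  filter_upwards [h1] with t ht
  refine ht.trans ?_
  have hI : 0 ≤ ∫ x, ‖w₀ x‖ ^ 2 := integral_nonneg fun x => by positivity
  have hE : 0 ≤ Real.exp (-(8 * Real.pi ^ 2 * Q * ν / (n:ℝ) ^ 2) * t) := (Real.exp_pos _).le
  exact mul_le_mul_of_nonneg_right (mul_le_mul_of_nonneg_right hC hE) hI

/-- `WordGainAtRate … 1` is monotone in the regime: smaller `ν₀`, larger `K`. -/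
theorem wordGainAtRate_one_mono {k : ℕ} (W : LatticeWord k) (c ν₀ ν₀' K K' : ℝ) (hν : ν₀' ≤ ν₀)
    (hKK : K ≤ K') (h : WordGainAtRate W c ν₀ K 1) : WordGainAtRate W c ν₀' K' 1 := by
  intro ν hν'
  have hνν : ν ∈ Set.Ioo 0 ν₀ := ⟨hν'.1, lt_of_lt_of_le hν'.2 hν⟩
  have h1 := h ν hνν
  have hq : K / ν ^ (1:ℝ) ≤ K' / ν ^ (1:ℝ) :=
    div_le_div_of_nonneg_right hKK (Real.rpow_nonneg hν'.1.le _)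
  exact solenoidalWordDecay_mono _ _ _ _ _ _ _ hq (Nat.ceil_mono hq) h1

end Summit.AnomalousDissipation.AnomalousDissipation.Theorems.SolenoidalFractalHomogenisation.RealisedQuasiStaticCellLaw

end
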